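import Summits.HubbardSuperconductivity.HubbardSuperconductivity.Theses.IsoperimetricCascade

/-!
# Route `IsoperimetricCascade` — support `CascadeToFloor` (stmt-HubbardSuperconductivity-11985)

`CascadeToFloor : FlatAGPNormGrowth → IsoCascade → PairFieldFloor`. At the witness
`(U, δ, r, C, γ, L₀)` of `IsoCascade` and with `(κ, L₁)` from `FlatAGPNormGrowth` at `(δ, r)`,
for even `L` large and every normalised sector ground state `ψ`, writing `μ₁ = ‖Δψ‖²`,
`μₙ = ‖Δⁿψ‖²`, `n = ⌊(1-δ)L²/2⌋ - r`, `Φ = (Δᴴ)ⁿ|0⟩`: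

  `e^{-γL²} (κL⁴)ⁿ ≤ e^{-γL²} ‖Φ‖² ≤ μₙ ≤ e^{Cn} μ₁ⁿ`,

so `μ₁ⁿ ≥ (e^{-C - γL²/n} κ L⁴)ⁿ` and, taking `n`-th roots (`n ≥ 1`, both bases nonnegative),
`μ₁ ≥ e^{-C - γL²/n} κ L⁴ ≥ e^{-C - 4γ⁺/(1-δ)} κ L⁴ =: a L⁴` (`γ⁺ = max γ 0`), because
`n ≥ (1-δ)L²/4` as soon as `(1-δ)L²/2 ≥ 2(r+1)` (guaranteed by `L ≥ ⌈4(r+1)/(1-δ)⌉`, using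
`L² ≥ L`). Elementary real analysis; the `let`-bound `n`, `Φ` of the two hypotheses coincide after
zeta-reduction. No new definitions. Source of the setting: A. J. Coleman, J. Math. Phys. 6 (1965)
1425; nothing from it is used.
-/

-- the mandated namespace `Summit.<Summit>.<Problem>.Theorems` repeats `HubbardSuperconductivity`
-- (single-problem summit, D-0017), which the `dupNamespace` linter flags on every declaration
set_option linter.dupNamespace false

namespace Summit.HubbardSuperconductivity.HubbardSuperconductivity.Theorems

open Matrix
open Literature.MathematicalPhysics.QuantumLattice
open scoped ComplexOrder

/-- The `n`-th-root step: from `e^{-γL²} (κL⁴)ⁿ ≤ μₙ ≤ e^{Cn} μ₁ⁿ` with `μ₁ ≥ 0`, `κ > 0`, `n ≥ 1`,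
conclude `e^{-C - γ L²/n} κ L⁴ ≤ μ₁`. [folklore] -/
theorem cascade_root_step {κ C γ Lr μ₁ μn : ℝ} {n : ℕ} (hn : 1 ≤ n) (hκ : 0 < κ)
    (hμ₁ : 0 ≤ μ₁)
    (hlow : Real.exp (-(γ * Lr ^ 2)) * (κ * Lr ^ 4) ^ n ≤ μn)
    (hup : μn ≤ Real.exp (C * n) * μ₁ ^ n) :
    Real.exp (-C - γ * Lr ^ 2 / n) * κ * Lr ^ 4 ≤ μ₁ := by
  have hn0 : (n : ℝ) ≠ 0 := by exact_mod_cast (show n ≠ 0 by omega)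
  have hchain : Real.exp (-(γ * Lr ^ 2)) * (κ * Lr ^ 4) ^ n ≤ Real.exp (C * n) * μ₁ ^ n :=
    hlow.trans hup
  -- rewrite the left side as (e^{-C-γL²/n} κ L⁴)^n · e^{Cn}
  have hpow : (Real.exp (-C - γ * Lr ^ 2 / n) * κ * Lr ^ 4) ^ n =
      Real.exp (-(C * n)) * (Real.exp (-(γ * Lr ^ 2)) * (κ * Lr ^ 4) ^ n) := by
    rw [mul_assoc, mul_pow, ← Real.exp_nat_mul, ← mul_assoc, ← Real.exp_add]
    congr 1
    · congr 1
      field_simp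
      ring
  have key : (Real.exp (-C - γ * Lr ^ 2 / n) * κ * Lr ^ 4) ^ n ≤ μ₁ ^ n := by
    rw [hpow]
    calc Real.exp (-(C * n)) * (Real.exp (-(γ * Lr ^ 2)) * (κ * Lr ^ 4) ^ n)
        ≤ Real.exp (-(C * n)) * (Real.exp (C * n) * μ₁ ^ n) :=
          mul_le_mul_of_nonneg_left hchain (Real.exp_pos _).le
      _ = μ₁ ^ n := by rw [← mul_assoc, ← Real.exp_add, neg_add_cancel, Real.exp_zero, one_mul]
  exact (pow_le_pow_iff_left₀ (by positivity) hμ₁ (by omega)).1 key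

/-- The counting step: for `0 < 1 - δ`, `L ≥ 1` real with `4 (r + 1) / (1 - δ) ≤ L`, the cascade
length `n = ⌊(1-δ)L²/2⌋ - r` satisfies `r ≤ ⌊(1-δ)L²/2⌋` and `(1-δ)L²/4 ≤ n`. [folklore] -/
theorem cascade_length_bound {δ : ℝ} {L r : ℕ} (hδ : 0 < 1 - δ) (hL1 : 1 ≤ L)
    (hL : 4 * ((r : ℝ) + 1) / (1 - δ) ≤ (L : ℝ)) :
    r ≤ ⌊(1 - δ) * (L : ℝ) ^ 2 / 2⌋₊ ∧
      (1 - δ) * (L : ℝ) ^ 2 / 4 ≤ ((⌊(1 - δ) * (L : ℝ) ^ 2 / 2⌋₊ - r : ℕ) : ℝ) := by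
  set x : ℝ := (1 - δ) * (L : ℝ) ^ 2 / 2 with hx
  have hLr : (1 : ℝ) ≤ (L : ℝ) := by exact_mod_cast hL1
  have hL2 : (L : ℝ) ≤ (L : ℝ) ^ 2 := by nlinarith
  have hx2 : 2 * ((r : ℝ) + 1) ≤ x := by
    rw [hx]
    rw [div_le_iff₀ hδ] at hL
    nlinarith
  have hfl : x - 1 < (⌊x⌋₊ : ℝ) := Nat.sub_one_lt_floor x
  have hr : (r : ℝ) ≤ (⌊x⌋₊ : ℝ) := by linarith
  have hrn : r ≤ ⌊x⌋₊ := by exact_mod_cast hr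
  refine ⟨hrn, ?_⟩
  rw [Nat.cast_sub hrn]
  linarith

/-- **CascadeToFloor** (item `stmt-HubbardSuperconductivity-11985`):
`FlatAGPNormGrowth → IsoCascade → PairFieldFloor` with
`a := e^{-C - 4γ⁺/(1-δ)} κ`, `γ⁺ = max γ 0`, and threshold `max L₀ (max L₁ ⌈4(r+1)/(1-δ)⌉)`.
[folklore] -/
theorem cascadeToFloor_proof :
    Summit.HubbardSuperconductivity.HubbardSuperconductivity.Theses.IsoperimetricCascade.CascadeToFloor := by
  unfold Summit.HubbardSuperconductivity.HubbardSuperconductivity.Theses.IsoperimetricCascade.CascadeToFloor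
    Summit.HubbardSuperconductivity.HubbardSuperconductivity.Theses.IsoperimetricCascade.FlatAGPNormGrowth
    Summit.HubbardSuperconductivity.HubbardSuperconductivity.Theses.IsoperimetricCascade.IsoCascade
    Summit.HubbardSuperconductivity.HubbardSuperconductivity.Theses.IsoperimetricCascade.PairFieldFloor
  rintro hGrowth ⟨U, hU, δ, hδ, r, C, γ, L₀, hCasc⟩
  have hδ1 : δ ∈ Set.Ioo (0 : ℝ) 1 := ⟨hδ.1, by linarith [hδ.2]⟩
  have hδpos : 0 < 1 - δ := by linarith [hδ.2]
  obtain ⟨κ, hκ, L₁, hGr⟩ := hGrowth δ hδ1 r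
  set γp : ℝ := max γ 0 with hγp
  refine ⟨U, hU, δ, hδ, Real.exp (-C - 4 * γp / (1 - δ)) * κ, by positivity,
    max L₀ (max L₁ ⌈4 * ((r : ℝ) + 1) / (1 - δ)⌉₊), ?_⟩
  intro L _ hL hEv ψ hψ1 hψ
  have hL0 : L₀ ≤ L := le_of_max_le_left hL
  have hL1' : L₁ ≤ L := le_of_max_le_left (le_of_max_le_right hL)
  have hLc : ⌈4 * ((r : ℝ) + 1) / (1 - δ)⌉₊ ≤ L := le_of_max_le_right (le_of_max_le_right hL)
  have hLpos : 1 ≤ L := Nat.pos_of_ne_zero (NeZero.ne L)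
  have hLreal : 4 * ((r : ℝ) + 1) / (1 - δ) ≤ (L : ℝ) := (Nat.ceil_le).1 hLc
  obtain ⟨hrn, hnbig⟩ := cascade_length_bound hδpos hLpos hLreal
  have hC := hCasc L hL0 hEv ψ hψ1 hψ
  have hG := hGr L hL1'
  dsimp only at hC hG
  obtain ⟨hA, hB⟩ := hC
  -- abbreviations
  set n : ℕ := ⌊(1 - δ) * (L : ℝ) ^ 2 / 2⌋₊ - r with hn
  set μ₁ : ℝ := (star (pairField dWaveFormFactor L *ᵥ ψ) ⬝ᵥ
    (pairField dWaveFormFactor L *ᵥ ψ)).re with hμ₁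
  set μn : ℝ := (star (pairField dWaveFormFactor L ^ n *ᵥ ψ) ⬝ᵥ
    (pairField dWaveFormFactor L ^ n *ᵥ ψ)).re with hμn
  set Φ := (pairField dWaveFormFactor L)ᴴ ^ n *ᵥ (vacuum : Fock (Orb (FermionTorus 2 L))) with hΦ
  have hμ₁nn : 0 ≤ μ₁ := (Complex.nonneg_iff.1 (dotProduct_star_self_nonneg _)).1
  have hn1 : 1 ≤ n := by
    have h4 : 0 < (1 - δ) * (L : ℝ) ^ 2 / 4 := by
      have : (0 : ℝ) < (L : ℝ) := by exact_mod_cast hLpos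
      positivity
    have : (0 : ℝ) < (n : ℝ) := h4.trans_le hnbig
    exact_mod_cast this
  -- chain the three inequalities
  have hlow : Real.exp (-(γ * (L : ℝ) ^ 2)) * (κ * (L : ℝ) ^ 4) ^ n ≤ μn :=
    (mul_le_mul_of_nonneg_left hG (Real.exp_pos _).le).trans hB
  have hroot := cascade_root_step hn1 hκ hμ₁nn hlow hA
  -- compare the exponents: γ L²/n ≤ 4 γ⁺/(1-δ)
  have hγ : γ ≤ γp := le_max_left _ _
  have hγp0 : 0 ≤ γp := le_max_right _ _
  have hnpos : (0 : ℝ) < (n : ℝ) := by exact_mod_cast hn1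
  have hfrac : (L : ℝ) ^ 2 / (n : ℝ) ≤ 4 / (1 - δ) := by
    rw [div_le_div_iff₀ hnpos hδpos]
    nlinarith
  have hexp_le : Real.exp (-C - 4 * γp / (1 - δ)) ≤ Real.exp (-C - γ * (L : ℝ) ^ 2 / n) := by
    apply Real.exp_le_exp.2
    have h1 : γ * (L : ℝ) ^ 2 / n ≤ γp * ((L : ℝ) ^ 2 / n) := by
      rw [mul_div_assoc]
      exact mul_le_mul_of_nonneg_right hγ (by positivity)
    have h2 : γp * ((L : ℝ) ^ 2 / n) ≤ γp * (4 / (1 - δ)) := mul_le_mul_of_nonneg_left hfrac hγp0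
    have h3 : γp * (4 / (1 - δ)) = 4 * γp / (1 - δ) := by ring
    linarith
  calc Real.exp (-C - 4 * γp / (1 - δ)) * κ * (L : ℝ) ^ 4
      ≤ Real.exp (-C - γ * (L : ℝ) ^ 2 / n) * κ * (L : ℝ) ^ 4 := by
        apply mul_le_mul_of_nonneg_right _ (by positivity)
        exact mul_le_mul_of_nonneg_right hexp_le hκ.le
    _ ≤ μ₁ := hroot

end Summit.HubbardSuperconductivity.HubbardSuperconductivity.Theorems
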